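import Mathlib
import Summits.Ventures.PercRepro2.Defs
import Summits.Ventures.PercRepro2.Harris
import Summits.Ventures.PercRepro2.CoinDefs
import Summits.Ventures.PercRepro2.CoinStarDefs
import Summits.Ventures.PercRepro2.CoinLsmCoreDefs
import Summits.Ventures.PercRepro2.CoinLsmCoreU
import Summits.Ventures.PercRepro2.CoinCoreGate
import Summits.Ventures.PercRepro2.CoinOrTailKDefs
import Summits.Ventures.PercRepro2.CoinOrTailKSums
import Summits.Ventures.PercRepro2.CoinOrTailKAlg
import Summits.Ventures.PercRepro2.CoinOrTailKCore
import Summits.Ventures.PercRepro2.CoinOrTailLsmCore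
import Summits.Ventures.PercRepro2.CoinTreeCore
import Summits.Ventures.PercRepro2.CoinKSureGen
import Summits.Ventures.PercRepro2.CoinFourAtomPush
import Summits.Ventures.PercRepro2.CoinChainCover

/-!
# The chain of THREE OR-vertices with covering markers (blind cell PercRepro2, night-2 g17;
proofs/NIGHT2-DARC.md §57.7)

`a'' → a' → a`: `a''` an OR-vertex of `U` (entries `ent''`), `a'` an OR-vertex of `U ∪ {a''}`
(entries `ent'`, the arc `a'' → a'` among them), `a` an OR-vertex of `U ∪ {a'', a'}` (entries
`ent`), ALL coins arbitrary; the markers cover the entries of the three levels.  Three level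
reductions make the two laws on `U` OR-tail values nested three deep — log-supermodular by
`rValK_mul_le_all` three times — and the four-atom sandwich on the core closes:
`darc_of_chain3Cover`, `darc_of_chain3TreeCover`.  (The nested law «chains of OR-vertices» of
§56.4 / §56.19 (a), in the kernel for covering markers.)
-/

namespace Summit.Ventures.PercRepro2.Coin

open Classical

section Chain3Cover

variable {V : Type*} {E : Type*} [Fintype V] [DecidableEq V] [Fintype E] [DecidableEq E]
  {R : Type*} [Field R] [LinearOrder R] [IsStrictOrderedRing R]
  {arcs : E → Finset (V × V)} {s : V} {U : Finset V} {ent ent' ent'' : Finset V}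
  {c c' c'' : V → E} {a a' a'' w : V}

/-- **THEOREM (row 2′DARC at a chain of THREE OR-vertices with covering markers).** `a''` an
OR-vertex of `U` entered from `ent'' ⊆ U`, `a'` an OR-vertex of `insert a'' U` entered from
`ent' ⊆ insert a'' U`, `a` an OR-vertex of `insert a' (insert a'' U)` entered from `ent`, ALL
coins arbitrary; the cluster law of `U` log-supermodular; the markers `m₁, m₂ ∈ U` covering the
entries (`ent'' ⊆ {m₁, m₂}`, `ent' ⊆ {a'', m₁, m₂}`, `ent ⊆ {a', a'', m₁, m₂}`);
`t, w ∉ U ∪ {a, a', a'', s}` ⟹ `DARC pr arcs s {t} m₁ m₂ a w`. -/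
theorem darc_of_chain3Cover (pr : E → R) (hp : IsProbVec pr) (hS : SameEnds arcs)
    (h'' : OrTailK arcs s U ent'' c'' a'') (h' : OrTailK arcs s (insert a'' U) ent' c' a')
    (h : OrTailK arcs s (insert a' (insert a'' U)) ent c a)
    {m₁ m₂ : V} (hm₁ : m₁ ∈ U) (hm₂ : m₂ ∈ U)
    (hcov'' : ∀ r ∈ ent'', r = m₁ ∨ r = m₂) (hcov' : ∀ r ∈ ent', r = a'' ∨ r = m₁ ∨ r = m₂)
    (hcov : ∀ r ∈ ent, r = a' ∨ r = a'' ∨ r = m₁ ∨ r = m₂)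
    (hν : ∀ W W', W ⊆ U → W' ⊆ U →
      prob pr (coreLevel arcs s U W) * prob pr (coreLevel arcs s U W') ≤
        prob pr (coreLevel arcs s U (W ∩ W')) * prob pr (coreLevel arcs s U (W ∪ W')))
    {t : V} (htC : t ∉ insert a (insert a' (insert a'' U))) (hts : t ≠ s) (hws : w ≠ s)
    (hwC : w ∉ insert a (insert a' (insert a'' U))) :
    DARC pr arcs s {t} m₁ m₂ a w := by
  have hC := h.closedInCoreU
  have ha''U : a'' ∉ U := h''.a_notin
  have ha'U : a' ∉ insert a'' U := h'.a_notin
  have haU : a ∉ insert a' (insert a'' U) := h.a_notin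
  have hm₁a : m₁ ≠ a := fun e => haU (e ▸ Finset.mem_insert_of_mem (Finset.mem_insert_of_mem hm₁))
  have hm₂a : m₂ ≠ a := fun e => haU (e ▸ Finset.mem_insert_of_mem (Finset.mem_insert_of_mem hm₂))
  have hm₁a' : m₁ ≠ a' := fun e => ha'U (e ▸ Finset.mem_insert_of_mem hm₁)
  have hm₂a' : m₂ ≠ a' := fun e => ha'U (e ▸ Finset.mem_insert_of_mem hm₂)
  have hm₁a'' : m₁ ≠ a'' := fun e => ha''U (e ▸ hm₁)
  have hm₂a'' : m₂ ≠ a'' := fun e => ha''U (e ▸ hm₂)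
  have hm₁C : m₁ ∈ insert a (insert a' (insert a'' U)) :=
    Finset.mem_insert_of_mem (Finset.mem_insert_of_mem (Finset.mem_insert_of_mem hm₁))
  have hm₂C : m₂ ∈ insert a (insert a' (insert a'' U)) :=
    Finset.mem_insert_of_mem (Finset.mem_insert_of_mem (Finset.mem_insert_of_mem hm₂))
  have haC : a ∈ insert a (insert a' (insert a'' U)) := Finset.mem_insert_self _ _
  unfold DARC
  rw [hC.phiC_gate_eq pr hS htC hts hm₁C hm₂C haC hws hwC]
  -- the marker functions and their invariances
  have hm1 : ∀ W : Finset V, (fun _ : Finset V => (1 : R)) (insert a W) = (fun _ => (1 : R)) W :=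
    fun _ => rfl
  have hm1' : ∀ W : Finset V, (fun _ : Finset V => (1 : R)) (insert a' W) = (fun _ => (1 : R)) W :=
    fun _ => rfl
  have hm1'' : ∀ W : Finset V, (fun _ : Finset V => (1 : R)) (insert a'' W) = (fun _ => (1 : R)) W :=
    fun _ => rfl
  have hmp : ∀ W : Finset V, (fun W : Finset V => if m₁ ∈ W then (1 : R) else 0) (insert a W) =
      (fun W : Finset V => if m₁ ∈ W then (1 : R) else 0) W := by
    intro W; simp only [Finset.mem_insert, hm₁a, false_or]
  have hmp' : ∀ W : Finset V, (fun W : Finset V => if m₁ ∈ W then (1 : R) else 0) (insert a' W) =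
      (fun W : Finset V => if m₁ ∈ W then (1 : R) else 0) W := by
    intro W; simp only [Finset.mem_insert, hm₁a', false_or]
  have hmp'' : ∀ W : Finset V, (fun W : Finset V => if m₁ ∈ W then (1 : R) else 0) (insert a'' W) =
      (fun W : Finset V => if m₁ ∈ W then (1 : R) else 0) W := by
    intro W; simp only [Finset.mem_insert, hm₁a'', false_or]
  have hmq : ∀ W : Finset V, (fun W : Finset V => if m₂ ∈ W then (1 : R) else 0) (insert a W) =
      (fun W : Finset V => if m₂ ∈ W then (1 : R) else 0) W := by
    intro W; simp only [Finset.mem_insert, hm₂a, false_or]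
  have hmq' : ∀ W : Finset V, (fun W : Finset V => if m₂ ∈ W then (1 : R) else 0) (insert a' W) =
      (fun W : Finset V => if m₂ ∈ W then (1 : R) else 0) W := by
    intro W; simp only [Finset.mem_insert, hm₂a', false_or]
  have hmq'' : ∀ W : Finset V, (fun W : Finset V => if m₂ ∈ W then (1 : R) else 0) (insert a'' W) =
      (fun W : Finset V => if m₂ ∈ W then (1 : R) else 0) W := by
    intro W; simp only [Finset.mem_insert, hm₂a'', false_or]
  have hmpq : ∀ W : Finset V,
      (fun W : Finset V => (if m₁ ∈ W then (1 : R) else 0) * (if m₂ ∈ W then (1 : R) else 0))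
        (insert a W) =
      (fun W : Finset V => (if m₁ ∈ W then (1 : R) else 0) * (if m₂ ∈ W then (1 : R) else 0)) W := by
    intro W; simp only [Finset.mem_insert, hm₁a, hm₂a, false_or]
  have hmpq' : ∀ W : Finset V,
      (fun W : Finset V => (if m₁ ∈ W then (1 : R) else 0) * (if m₂ ∈ W then (1 : R) else 0))
        (insert a' W) =
      (fun W : Finset V => (if m₁ ∈ W then (1 : R) else 0) * (if m₂ ∈ W then (1 : R) else 0)) W := by
    intro W; simp only [Finset.mem_insert, hm₁a', hm₂a', false_or]
  have hmpq'' : ∀ W : Finset V,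
      (fun W : Finset V => (if m₁ ∈ W then (1 : R) else 0) * (if m₂ ∈ W then (1 : R) else 0))
        (insert a'' W) =
      (fun W : Finset V => (if m₁ ∈ W then (1 : R) else 0) * (if m₂ ∈ W then (1 : R) else 0)) W := by
    intro W; simp only [Finset.mem_insert, hm₁a'', hm₂a'', false_or]
  -- the level reduction over `a` (core `insert a' (insert a'' U)`)
  have eΛ := h.sum_R_eq pr t (fun _ => (1 : R)) hm1
  have eFa := h.sum_R_eq pr t (fun W => if m₁ ∈ W then (1 : R) else 0) hmp
  have eFb := h.sum_R_eq pr t (fun W => if m₂ ∈ W then (1 : R) else 0) hmq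
  have eM := h.sum_G_eq (w := w) pr t (fun _ => (1 : R)) hm1
  have eX := h.sum_G_eq (w := w) pr t (fun W => if m₁ ∈ W then (1 : R) else 0) hmp
  have eY := h.sum_G_eq (w := w) pr t (fun W => if m₂ ∈ W then (1 : R) else 0) hmq
  have eXY := h.sum_G_eq (w := w) pr t
    (fun W => (if m₁ ∈ W then (1 : R) else 0) * (if m₂ ∈ W then (1 : R) else 0)) hmpq
  simp only [mul_one] at eΛ eM
  rw [eΛ, eFa, eFb, eM, eX, eY, eXY]
  set A : Finset V → R :=
    fun X => prob pr (coreAvoidEvent arcs s t (insert a (insert a' (insert a'' U))) X) with hAdef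
  -- the inner OR-tail values (level `a`) and the middle ones (level `a'`)
  obtain ⟨hA0, hAmono, hAlsm⟩ :=
    OrTailU.head_props (U := insert a' (insert a'' U)) (a := a) pr hp hS t
  have hp0 := hp.nonneg
  have hp1 := hp.le_one
  set FR : Finset V → R := rValK A pr ent c a with hFR
  set FG : Finset V → R := gValK A pr ent c a w with hFG
  have hFR0 : ∀ W, 0 ≤ FR W := fun W => rValK_nonneg hp0 hp1 hA0 ent c a W
  have hFG0 : ∀ W, 0 ≤ FG W := fun W => gValK_nonneg hp0 hp1 hA0 ent c a w W
  have hFRlsm : ∀ s t : Finset V, FR s * FR t ≤ FR (s ∩ t) * FR (s ∪ t) :=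
    fun s t => rValK_mul_le_all A pr ent c a hp0 hp1 hA0 hAlsm hAmono s t
  have hFGlsm : ∀ s t : Finset V, FG s * FG t ≤ FG (s ∩ t) * FG (s ∪ t) :=
    fun s t => gValK_mul_le_all A pr ent c a w hp0 hp1 hA0 hAlsm hAmono s t
  have hFRmono : ∀ s t : Finset V, s ⊆ t → FR t ≤ FR s :=
    fun s t hst => rValK_antitone hp0 hp1 hAmono ent c a hst
  have hFGmono : ∀ s t : Finset V, s ⊆ t → FG t ≤ FG s :=
    fun s t hst => gValK_antitone hp0 hp1 hAmono ent c a w hst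
  have hFGle : ∀ W, FG W ≤ FR W := fun W => gValK_le_rValK hp0 hp1 hAmono ent c a w W
  set MR : Finset V → R := rValK FR pr ent' c' a' with hMR
  set MG : Finset V → R := rValK FG pr ent' c' a' with hMG
  have hMR0 : ∀ W, 0 ≤ MR W := fun W => rValK_nonneg hp0 hp1 hFR0 ent' c' a' W
  have hMG0 : ∀ W, 0 ≤ MG W := fun W => rValK_nonneg hp0 hp1 hFG0 ent' c' a' W
  have hMRlsm : ∀ s t : Finset V, MR s * MR t ≤ MR (s ∩ t) * MR (s ∪ t) :=
    fun s t => rValK_mul_le_all FR pr ent' c' a' hp0 hp1 hFR0 hFRlsm hFRmono s t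
  have hMGlsm : ∀ s t : Finset V, MG s * MG t ≤ MG (s ∩ t) * MG (s ∪ t) :=
    fun s t => rValK_mul_le_all FG pr ent' c' a' hp0 hp1 hFG0 hFGlsm hFGmono s t
  have hMRmono : ∀ s t : Finset V, s ⊆ t → MR t ≤ MR s :=
    fun s t hst => rValK_antitone hp0 hp1 hFRmono ent' c' a' hst
  have hMGmono : ∀ s t : Finset V, s ⊆ t → MG t ≤ MG s :=
    fun s t hst => rValK_antitone hp0 hp1 hFGmono ent' c' a' hst
  have hMGle : ∀ W, MG W ≤ MR W := fun W => rValK_head_le hp0 hp1 hFGle ent' c' a' W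
  -- the level reduction over `a'` (core `insert a'' U`)
  have fΛ := h'.sum_gen pr FR (fun _ => (1 : R)) hm1'
  have fFa := h'.sum_gen pr FR (fun W => if m₁ ∈ W then (1 : R) else 0) hmp'
  have fFb := h'.sum_gen pr FR (fun W => if m₂ ∈ W then (1 : R) else 0) hmq'
  have fM := h'.sum_gen pr FG (fun _ => (1 : R)) hm1'
  have fX := h'.sum_gen pr FG (fun W => if m₁ ∈ W then (1 : R) else 0) hmp'
  have fY := h'.sum_gen pr FG (fun W => if m₂ ∈ W then (1 : R) else 0) hmq'
  have fXY := h'.sum_gen pr FG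
    (fun W => (if m₁ ∈ W then (1 : R) else 0) * (if m₂ ∈ W then (1 : R) else 0)) hmpq'
  simp only [mul_one] at fΛ fM
  rw [fΛ, fFa, fFb, fM, fX, fY, fXY]
  have foldR : ∀ x, tailWtK pr ent' c' x * FR x + (1 - tailWtK pr ent' c' x) * FR (x ∪ {a'}) = MR x :=
    fun x => rfl
  have foldG : ∀ x, tailWtK pr ent' c' x * FG x + (1 - tailWtK pr ent' c' x) * FG (x ∪ {a'}) = MG x :=
    fun x => rfl
  simp only [foldR, foldG]
  -- the level reduction over `a''` (core `U`)
  have gΛ := h''.sum_gen pr MR (fun _ => (1 : R)) hm1''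
  have gFa := h''.sum_gen pr MR (fun W => if m₁ ∈ W then (1 : R) else 0) hmp''
  have gFb := h''.sum_gen pr MR (fun W => if m₂ ∈ W then (1 : R) else 0) hmq''
  have gM := h''.sum_gen pr MG (fun _ => (1 : R)) hm1''
  have gX := h''.sum_gen pr MG (fun W => if m₁ ∈ W then (1 : R) else 0) hmp''
  have gY := h''.sum_gen pr MG (fun W => if m₂ ∈ W then (1 : R) else 0) hmq''
  have gXY := h''.sum_gen pr MG
    (fun W => (if m₁ ∈ W then (1 : R) else 0) * (if m₂ ∈ W then (1 : R) else 0)) hmpq''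
  simp only [mul_one] at gΛ gM
  rw [gΛ, gFa, gFb, gM, gX, gY, gXY]
  -- the two laws on the core
  set ν : Finset V → R := fun W => prob pr (coreLevel arcs s U W) with hνdef
  have hν0 : ∀ W, 0 ≤ ν W := fun W => prob_nonneg hp _
  set G : Finset V → R := fun W => ν W * rValK MR pr ent'' c'' a'' W with hGdef
  set G' : Finset V → R := fun W => ν W * rValK MG pr ent'' c'' a'' W with hG'def
  have hG0 : ∀ W, 0 ≤ G W := fun W => mul_nonneg (hν0 W) (rValK_nonneg hp0 hp1 hMR0 ent'' c'' a'' W)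
  have hG'0 : ∀ W, 0 ≤ G' W := fun W => mul_nonneg (hν0 W) (rValK_nonneg hp0 hp1 hMG0 ent'' c'' a'' W)
  have wLL : ∀ s ⊆ U, ∀ t ⊆ U, G s * G t ≤ G (s ∩ t) * G (s ∪ t) := by
    intro s hs t ht
    simp only [hGdef]
    calc ν s * rValK MR pr ent'' c'' a'' s * (ν t * rValK MR pr ent'' c'' a'' t)
        = (ν s * ν t) * (rValK MR pr ent'' c'' a'' s * rValK MR pr ent'' c'' a'' t) := by ring
      _ ≤ (ν (s ∩ t) * ν (s ∪ t)) *
            (rValK MR pr ent'' c'' a'' (s ∩ t) * rValK MR pr ent'' c'' a'' (s ∪ t)) :=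
          mul_le_mul (hν s t hs ht)
            (rValK_mul_le_all MR pr ent'' c'' a'' hp0 hp1 hMR0 hMRlsm hMRmono s t)
            (mul_nonneg (rValK_nonneg hp0 hp1 hMR0 ent'' c'' a'' _)
              (rValK_nonneg hp0 hp1 hMR0 ent'' c'' a'' _))
            (mul_nonneg (hν0 _) (hν0 _))
      _ = _ := by ring
  have wMM : ∀ s ⊆ U, ∀ t ⊆ U, G' s * G' t ≤ G' (s ∩ t) * G' (s ∪ t) := by
    intro s hs t ht
    simp only [hG'def]
    calc ν s * rValK MG pr ent'' c'' a'' s * (ν t * rValK MG pr ent'' c'' a'' t)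
        = (ν s * ν t) * (rValK MG pr ent'' c'' a'' s * rValK MG pr ent'' c'' a'' t) := by ring
      _ ≤ (ν (s ∩ t) * ν (s ∪ t)) *
            (rValK MG pr ent'' c'' a'' (s ∩ t) * rValK MG pr ent'' c'' a'' (s ∪ t)) :=
          mul_le_mul (hν s t hs ht)
            (rValK_mul_le_all MG pr ent'' c'' a'' hp0 hp1 hMG0 hMGlsm hMGmono s t)
            (mul_nonneg (rValK_nonneg hp0 hp1 hMG0 ent'' c'' a'' _)
              (rValK_nonneg hp0 hp1 hMG0 ent'' c'' a'' _))
            (mul_nonneg (hν0 _) (hν0 _))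
      _ = _ := by ring
  have hle : ∀ W ∈ U.powerset, G' W ≤ G W := fun W _ =>
    mul_le_mul_of_nonneg_left (rValK_head_le hp0 hp1 hMGle ent'' c'' a'' W) (hν0 W)
  have h00 : ∀ W ∈ U.powerset, m₁ ∉ W → m₂ ∉ W → G' W = G W := by
    intro W hW h1 h2
    have hWU : W ⊆ U := Finset.mem_powerset.1 hW
    have ha''W : a'' ∉ W := fun hx => ha''U (hWU hx)
    have ha'W : a' ∉ W := fun hx => ha'U (Finset.mem_insert_of_mem (hWU hx))
    have hno'' : ∀ r ∈ ent'', r ∉ W := by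
      intro r hr hrW
      rcases hcov'' r hr with rfl | rfl
      · exact h1 hrW
      · exact h2 hrW
    have hno' : ∀ r ∈ ent', r ∉ W := by
      intro r hr hrW
      rcases hcov' r hr with rfl | rfl | rfl
      · exact ha''W hrW
      · exact h1 hrW
      · exact h2 hrW
    have hno : ∀ r ∈ ent, r ∉ W := by
      intro r hr hrW
      rcases hcov r hr with rfl | rfl | rfl | rfl
      · exact ha'W hrW
      · exact ha''W hrW
      · exact h1 hrW
      · exact h2 hrW
    simp only [hGdef, hG'def]
    rw [rValK_eq_of_no_entry MR pr c'' a'' hno'', rValK_eq_of_no_entry MG pr c'' a'' hno'']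
    simp only [hMR, hMG]
    rw [rValK_eq_of_no_entry FR pr c' a' hno', rValK_eq_of_no_entry FG pr c' a' hno']
    simp only [hFR, hFG]
    rw [gValK_eq_rValK_of_no_entry A pr c a w hno]
  exact fourAtom_functional_nonneg' U G G' m₁ m₂ hG0 hG'0 wLL wMM hle h00

/-- **COROLLARY (out-tree core).** -/
theorem darc_of_chain3TreeCover (pr : E → R) (hp : IsProbVec pr) (hS : SameEnds arcs)
    (h'' : OrTailK arcs s U ent'' c'' a'') (h' : OrTailK arcs s (insert a'' U) ent' c' a')
    (h : OrTailK arcs s (insert a' (insert a'' U)) ent c a)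
    {cT : V → E} {par : V → V} {rk : V → ℕ} (hT : TreeCore arcs s U cT par rk)
    {m₁ m₂ : V} (hm₁ : m₁ ∈ U) (hm₂ : m₂ ∈ U)
    (hcov'' : ∀ r ∈ ent'', r = m₁ ∨ r = m₂) (hcov' : ∀ r ∈ ent', r = a'' ∨ r = m₁ ∨ r = m₂)
    (hcov : ∀ r ∈ ent, r = a' ∨ r = a'' ∨ r = m₁ ∨ r = m₂)
    {t : V} (htC : t ∉ insert a (insert a' (insert a'' U))) (hts : t ≠ s) (hws : w ≠ s)
    (hwC : w ∉ insert a (insert a' (insert a'' U))) :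
    DARC pr arcs s {t} m₁ m₂ a w :=
  darc_of_chain3Cover pr hp hS h'' h' h hm₁ hm₂ hcov'' hcov' hcov (hT.coreLevel_lsm pr hp) htC
    hts hws hwC

end Chain3Cover

end Summit.Ventures.PercRepro2.Coin
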